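import Summits.CriticalPhenomena.PercolationContinuityZ3.Theorems.PercNearOneGluingNoHeavyLowerTailThreePointHalvingTransplant
import HarnessLib

/-!
# The DICTIONARY PRINCIPLE for the three-point core `μ(sac)·μ(s|a|c)` (Sahi programme, prover prim-sahi-p2 gen 52)

Support file (`--supports stmt-CriticalPhenomena-4575`, helper), continuing `…ThreePointHalvingTransplant` (gen 43); companion file
`…ThreePointTransplantRecipes` supplies the weight-preserving injections ('transplant recipes') this principle is fed with.  Standard axioms,
no sorries, no named facts.  Memo `run/shared/lean/prim/prim-sahi/FROM-prim-sahi-p2-gen52-TRANSPLANT-DICTIONARY.md`, `prim-sahi-p2/PROOF-E3.md` §62.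

SETTING.  Bernoulli bond percolation `μ = prodBernoulli w` (arbitrary weights, finite vertex type `V`), terminals `s, a, c`, cells
`T = μ(sac)`, `p₁ = μ(sa|c)`, `p₂ = μ(ac|s)`, `p₃ = μ(sc|a)`, `p₀ = μ(s|a|c)`, `X = p₁ + p₂ = μ(U ∩ D)` (`U = {a↔s}∪{a↔c}`, `D = {s↮c}`).
ANY bound `T·p₀ ≤ C·X` valid on all weighted graphs gives the halving lemma with a constant, `μ(U)μ(D) ≤ (C+1)μ(U∩D)` (because
`μ(U)μ(D) = T·p₀ + X(1−p₃)`, `halving_const_of_core`), hence Gladkov's three-cluster dichotomy (arXiv:2408.08457 Thm 1.3, tree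
`GladkovThreeClusterDichotomy`) with the QUADRATIC rate `δ = ε²/(2C)` in place of the printed `ε³/4` (`dichotomy_of_core`); no such `C` is
known.  `T·p₀` is the mass of the PAIRS `(θ₁, θ₂)` of independent copies with `θ₁ ∈ sac =: J`, `θ₂ ∈ s|a|c =: S0` (`real_mul_real_eq_sum_wt2`).

WHAT IS PROVED (all graphs, all weights).
* `sum_weight_eq_one`, `real_mul_real_eq_sum_wt2` — `μ(A)μ(B)` as a two-copy weighted count with weight `w(θ₁)·w(θ₂)`. [folklore]
* **`sum_le_card_mul_sum_of_cover`** — the abstract DICTIONARY PRINCIPLE: finitely many weight-preserving injections covering a finite set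
  `A` pointwise into a set `T` give `Σ_A wt ≤ #maps · Σ_T wt`. [folklore counting]
* **`core_le_of_cover`** [this work] — for every finite family of weight-preserving injections of `BondConfig V × BondConfig V` sending each
  pair of `J × S0` into the target `{θ₁ ∈ X} ∪ {θ₂ ∈ X}` (`X = sa|c ∪ ac|s`):  `μ(sac)·μ(s|a|c) ≤ 2·#family·μ(sa|c ∪ ac|s)`.
* `halving_const_of_core`, `dichotomy_of_core` — the cell arithmetic `T·p₀ ≤ C·X ⟹ (T+X)(p₀+X) ≤ (C+1)X` and `⟹ (p₁, p₂ < ε²/(2C) ⟹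
  T < ε ∨ p₀ < ε)`. [this work]
CONJECTURE DICT-2 (NOT asserted here; exact enumeration, kit j337630: 3 584 graphs/markings up to 15–16 pairs incl. Petersen, K₄₄, Q₃, K₆,
1.03·10⁹ pairs, ZERO exceptions): the 600 words of length ≤ 2 in the 24 transplant recipes of `…ThreePointTransplantRecipes` cover `J × S0`
on every finite graph; by `core_le_of_cover` this would give `T·p₀ ≤ 1200·X` universally, hence the quadratic rate.
[cite: Gladkov2024, Lemma 3.1 (the product law of a hybrid — here replaced by bijections of pairs), Thm 1.3 (the dichotomy, δ = ε³/4)].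
-/

noncomputable section

open Classical

namespace Summit.CriticalPhenomena.PercolationContinuityZ3.Theorems

namespace TransplantDictionary

open MeasureTheory Finset
open Literature.Probability.Percolation Literature.Probability.LatticeModels
open Literature.Probability.Percolation.BHK2006 (weight weight_nonneg)
open Literature.Probability.Percolation.DecisionTree (ind ind_of_mem ind_of_not_mem ind_nonneg)
open Literature.Probability.Percolation.ClusterConditioning (cutSet)

variable {V : Type*} [Fintype V]

/-! ### 4. The abstract dictionary principle -/

omit [Fintype V] in
/-- **DICTIONARY PRINCIPLE** (counting): if finitely many weight-preserving injections `f i`, `i ∈ W`, cover the finite set `A` pointwise into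
`T` (`∀ x ∈ A, ∃ i ∈ W, f i x ∈ T`), then `Σ_{x ∈ A} wt x ≤ #W · Σ_{y ∈ T} wt y`. [folklore] -/
theorem sum_le_card_mul_sum_of_cover {α ι : Type*} [DecidableEq α] (wt : α → ℝ) (hwt : ∀ x, 0 ≤ wt x)
    (A T : Finset α) (W : Finset ι) (f : ι → α → α) (hinj : ∀ i ∈ W, Function.Injective (f i))
    (hwf : ∀ i ∈ W, ∀ x, wt (f i x) = wt x) (hcov : ∀ x ∈ A, ∃ i ∈ W, f i x ∈ T) :
    ∑ x ∈ A, wt x ≤ W.card * ∑ y ∈ T, wt y := by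
  classical
  -- each `x ∈ A` is counted at least once in the double sum over `(i, x)` with `f i x ∈ T`
  have h1 : ∑ x ∈ A, wt x ≤ ∑ x ∈ A, ∑ i ∈ W, (if f i x ∈ T then wt x else 0) := by
    refine Finset.sum_le_sum fun x hx => ?_
    obtain ⟨i, hi, hT⟩ := hcov x hx
    calc wt x = (if f i x ∈ T then wt x else 0) := by rw [if_pos hT]
      _ ≤ ∑ j ∈ W, (if f j x ∈ T then wt x else 0) :=
          Finset.single_le_sum (f := fun j => if f j x ∈ T then wt x else 0)
            (fun j _ => by split_ifs <;> [exact hwt x; exact le_rfl]) hi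
  refine h1.trans ?_
  rw [Finset.sum_comm]
  -- for each word, the landed part of `A` is mapped injectively into `T` with the same weights
  have h2 : ∀ i ∈ W, ∑ x ∈ A, (if f i x ∈ T then wt x else 0) ≤ ∑ y ∈ T, wt y := by
    intro i hi
    rw [← Finset.sum_filter]
    have hinj' : Set.InjOn (f i) ↑(A.filter fun x => f i x ∈ T) := fun x _ y _ h => hinj i hi h
    calc ∑ x ∈ A.filter (fun x => f i x ∈ T), wt x
        = ∑ x ∈ A.filter (fun x => f i x ∈ T), wt (f i x) := Finset.sum_congr rfl fun x _ => (hwf i hi x).symm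
      _ = ∑ y ∈ (A.filter fun x => f i x ∈ T).image (f i), wt y := (Finset.sum_image hinj').symm
      _ ≤ ∑ y ∈ T, wt y := by
          refine Finset.sum_le_sum_of_subset_of_nonneg ?_ fun y _ _ => hwt y
          intro y hy
          obtain ⟨x, hx, rfl⟩ := Finset.mem_image.1 hy
          exact (Finset.mem_filter.1 hx).2
  calc ∑ i ∈ W, ∑ x ∈ A, (if f i x ∈ T then wt x else 0) ≤ ∑ i ∈ W, ∑ y ∈ T, wt y := Finset.sum_le_sum h2
    _ = W.card * ∑ y ∈ T, wt y := by rw [Finset.sum_const, nsmul_eq_mul]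

/-! ### 5. The percolation statement: the core `μ(sac)·μ(s|a|c)` under a cover -/

/-- `Σ_ω w(ω) = 1` for the product weights of a weight function with values in `[0,1]`. [folklore] -/
theorem sum_weight_eq_one (w : Sym2 V → unitInterval) : ∑ ω : BondConfig V, weight (fun e => (w e : ℝ)) ω = 1 := by
  have h := prodBernoulli_real_eq_sum_weight_ind w (Set.univ : Set (BondConfig V))
  simp only [ind_of_mem (Set.mem_univ _), mul_one, probReal_univ] at h
  exact h.symm

/-- A product of two event probabilities as a two-copy weighted count. [folklore] -/
theorem real_mul_real_eq_sum_wt2 (w : Sym2 V → unitInterval) (A B : Set (BondConfig V)) :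
    (prodBernoulli w).real A * (prodBernoulli w).real B =
      ∑ θ : BondConfig V × BondConfig V, (weight (fun e => (w e : ℝ)) θ.1 * weight (fun e => (w e : ℝ)) θ.2) * (ind A θ.1 * ind B θ.2) := by
  rw [prodBernoulli_real_eq_sum_weight_ind, prodBernoulli_real_eq_sum_weight_ind, Finset.sum_mul_sum,
    ← Finset.univ_product_univ, Finset.sum_product]
  refine Finset.sum_congr rfl fun θ₁ _ => Finset.sum_congr rfl fun θ₂ _ => ?_
  ring

/-- **THE DICTIONARY PRINCIPLE FOR THE THREE-POINT CORE.**  Let `W` be a finite family of maps of `BondConfig V × BondConfig V`, each injective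
and preserving the two-copy weight (e.g. words in the transplant recipes of `…ThreePointTransplantRecipes`), such that every pair
`(θ₁ ∈ sac, θ₂ ∈ s|a|c)` is sent by some member into `{θ₁ ∈ X} ∪ {θ₂ ∈ X}`, `X = sa|c ∪ ac|s`.  Then
`μ(sac) · μ(s|a|c) ≤ 2 · #W · μ(sa|c ∪ ac|s)`. [this work] -/
theorem core_le_of_cover (w : Sym2 V → unitInterval) (s a c : V) {ι : Type*} (W : Finset ι)
    (f : ι → BondConfig V × BondConfig V → BondConfig V × BondConfig V)
    (hinj : ∀ i ∈ W, Function.Injective (f i))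
    (hwf : ∀ i ∈ W, ∀ θ, weight (fun e => (w e : ℝ)) (f i θ).1 * weight (fun e => (w e : ℝ)) (f i θ).2 =
        weight (fun e => (w e : ℝ)) θ.1 * weight (fun e => (w e : ℝ)) θ.2)
    (hcov : ∀ θ : BondConfig V × BondConfig V,
      θ.1 ∈ (openConn s a ∩ openConn s c : Set (BondConfig V)) →
      θ.2 ∈ ((openConn s a)ᶜ ∩ (openConn s c)ᶜ ∩ (openConn a c)ᶜ : Set (BondConfig V)) →
        ∃ i ∈ W, (f i θ).1 ∈ ((openConn s a ∩ (openConn s c)ᶜ) ∪ (openConn c a ∩ (openConn c s)ᶜ) : Set (BondConfig V)) ∨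
                 (f i θ).2 ∈ ((openConn s a ∩ (openConn s c)ᶜ) ∪ (openConn c a ∩ (openConn c s)ᶜ) : Set (BondConfig V))) :
    (prodBernoulli w).real (openConn s a ∩ openConn s c) *
        (prodBernoulli w).real ((openConn s a)ᶜ ∩ (openConn s c)ᶜ ∩ (openConn a c)ᶜ) ≤
      2 * W.card * (prodBernoulli w).real ((openConn s a ∩ (openConn s c)ᶜ) ∪ (openConn c a ∩ (openConn c s)ᶜ)) := by
  classical
  set J : Set (BondConfig V) := openConn s a ∩ openConn s c with hJ
  set S0 : Set (BondConfig V) := (openConn s a)ᶜ ∩ (openConn s c)ᶜ ∩ (openConn a c)ᶜ with hS0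
  set X : Set (BondConfig V) := (openConn s a ∩ (openConn s c)ᶜ) ∪ (openConn c a ∩ (openConn c s)ᶜ) with hX
  set wt : BondConfig V × BondConfig V → ℝ := fun θ => weight (fun e => (w e : ℝ)) θ.1 * weight (fun e => (w e : ℝ)) θ.2 with hwt
  have hw0 : ∀ e, 0 ≤ ((w e : unitInterval) : ℝ) := fun e => (w e).2.1
  have hw1 : ∀ e, ((w e : unitInterval) : ℝ) ≤ 1 := fun e => (w e).2.2
  have hwt0 : ∀ θ, 0 ≤ wt θ := fun θ => mul_nonneg (weight_nonneg hw0 hw1 _) (weight_nonneg hw0 hw1 _)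
  -- the domain and target as finite sets of pairs
  set A : Finset (BondConfig V × BondConfig V) := Finset.univ.filter fun θ => θ.1 ∈ J ∧ θ.2 ∈ S0 with hA
  set T : Finset (BondConfig V × BondConfig V) := Finset.univ.filter fun θ => θ.1 ∈ X ∨ θ.2 ∈ X with hT
  -- LHS = Σ_A wt
  have hL : (prodBernoulli w).real J * (prodBernoulli w).real S0 = ∑ θ ∈ A, wt θ := by
    rw [real_mul_real_eq_sum_wt2, hA, Finset.sum_filter]
    refine Finset.sum_congr rfl fun θ _ => ?_
    by_cases h1 : θ.1 ∈ J <;> by_cases h2 : θ.2 ∈ S0 <;>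
      simp [ind_of_mem, ind_of_not_mem, h1, h2, hwt]
  -- Σ_T wt ≤ 2 μ(X)
  have hsum1 : ∑ ω : BondConfig V, weight (fun e => (w e : ℝ)) ω = 1 := sum_weight_eq_one w
  have hXsum : (prodBernoulli w).real X = ∑ ω : BondConfig V, weight (fun e => (w e : ℝ)) ω * ind X ω :=
    prodBernoulli_real_eq_sum_weight_ind w X
  have hT1 : ∑ θ ∈ T, wt θ ≤ ∑ θ : BondConfig V × BondConfig V, wt θ * (ind X θ.1 + ind X θ.2) := by
    rw [hT, Finset.sum_filter]
    refine Finset.sum_le_sum fun θ _ => ?_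
    have hθ := hwt0 θ
    by_cases h1 : θ.1 ∈ X
    · by_cases h2 : θ.2 ∈ X
      · rw [if_pos (Or.inl h1), ind_of_mem h1, ind_of_mem h2]; nlinarith
      · rw [if_pos (Or.inl h1), ind_of_mem h1, ind_of_not_mem h2]; nlinarith
    · by_cases h2 : θ.2 ∈ X
      · rw [if_pos (Or.inr h2), ind_of_not_mem h1, ind_of_mem h2]; nlinarith
      · rw [if_neg (not_or.2 ⟨h1, h2⟩), ind_of_not_mem h1, ind_of_not_mem h2]; nlinarith
  have hT2 : ∑ θ : BondConfig V × BondConfig V, wt θ * (ind X θ.1 + ind X θ.2) = 2 * (prodBernoulli w).real X := by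
    simp only [mul_add, Finset.sum_add_distrib]
    rw [← Finset.univ_product_univ, Finset.sum_product, Finset.sum_product]
    have e1 : ∑ θ₁ : BondConfig V, ∑ θ₂ : BondConfig V, wt (θ₁, θ₂) * ind X (θ₁, θ₂).1 = (prodBernoulli w).real X := by
      rw [hXsum]
      refine Finset.sum_congr rfl fun θ₁ _ => ?_
      simp only [hwt]
      rw [← Finset.sum_mul, ← Finset.mul_sum, hsum1]; ring
    have e2 : ∑ θ₁ : BondConfig V, ∑ θ₂ : BondConfig V, wt (θ₁, θ₂) * ind X (θ₁, θ₂).2 = (prodBernoulli w).real X := by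
      rw [Finset.sum_comm, hXsum]
      refine Finset.sum_congr rfl fun θ₂ _ => ?_
      simp only [hwt]
      rw [← Finset.sum_mul, ← Finset.sum_mul, hsum1]; ring
    rw [e1, e2]; ring
  -- cover
  have hcov' : ∀ θ ∈ A, ∃ i ∈ W, f i θ ∈ T := by
    intro θ hθ
    have hθ' := (Finset.mem_filter.1 hθ).2
    obtain ⟨i, hi, h⟩ := hcov θ hθ'.1 hθ'.2
    exact ⟨i, hi, Finset.mem_filter.2 ⟨Finset.mem_univ _, h⟩⟩
  have hwf' : ∀ i ∈ W, ∀ θ, wt (f i θ) = wt θ := fun i hi θ => by simp only [hwt]; exact hwf i hi θ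
  have hmain := sum_le_card_mul_sum_of_cover wt hwt0 A T W f hinj hwf' hcov'
  have hcard : (0 : ℝ) ≤ W.card := Nat.cast_nonneg _
  calc (prodBernoulli w).real J * (prodBernoulli w).real S0 = ∑ θ ∈ A, wt θ := hL
    _ ≤ W.card * ∑ θ ∈ T, wt θ := hmain
    _ ≤ W.card * (2 * (prodBernoulli w).real X) := by
        exact mul_le_mul_of_nonneg_left (hT1.trans hT2.le) hcard
    _ = 2 * W.card * (prodBernoulli w).real X := by ring

/-! ### 6. Cell arithmetic: from the core bound to the halving constant and the dichotomy -/

omit [Fintype V] in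
/-- **Core ⟹ halving with a constant**: for nonnegative cells with `T + p₁ + p₂ + p₃ + p₀ = 1`, `T·p₀ ≤ C·(p₁+p₂)` gives
`(T + p₁ + p₂)·(p₀ + p₁ + p₂) ≤ (C + 1)·(p₁ + p₂)`, i.e. `μ(U)μ(D) ≤ (C+1)μ(U ∩ D)`. [this work] -/
theorem halving_const_of_core {T p₁ p₂ p₃ p₀ C : ℝ} (h1 : 0 ≤ p₁) (h2 : 0 ≤ p₂) (h3 : 0 ≤ p₃)
    (hsum : T + p₁ + p₂ + p₃ + p₀ = 1) (hcore : T * p₀ ≤ C * (p₁ + p₂)) :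
    (T + p₁ + p₂) * (p₀ + p₁ + p₂) ≤ (C + 1) * (p₁ + p₂) := by
  have hX : 0 ≤ p₁ + p₂ := add_nonneg h1 h2
  have key : (T + p₁ + p₂) * (p₀ + p₁ + p₂) = T * p₀ + (p₁ + p₂) * (1 - p₃) := by
    have : p₀ = 1 - T - p₁ - p₂ - p₃ := by linarith
    subst this; ring
  rw [key]
  nlinarith [mul_nonneg hX h3]

omit [Fintype V] in
/-- **Core ⟹ Gladkov's dichotomy with quadratic rate**: if `T·p₀ ≤ C·(p₁+p₂)` with `C > 0`, `ε > 0`, and both `p₁ < δ`, `p₂ < δ` for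
`δ = ε²/(2C)`, then `T < ε` or `p₀ < ε`. [this work; cf. Gladkov2024 Thm 1.3 (δ = ε³/4)] -/
theorem dichotomy_of_core {T p₁ p₂ p₀ C ε : ℝ} (hT : 0 ≤ T) (hC : 0 < C) (hε : 0 < ε)
    (hcore : T * p₀ ≤ C * (p₁ + p₂)) (hp1 : p₁ < ε ^ 2 / (2 * C)) (hp2 : p₂ < ε ^ 2 / (2 * C)) :
    T < ε ∨ p₀ < ε := by
  by_contra hcon
  rw [not_or, not_lt, not_lt] at hcon
  obtain ⟨hTe, h0e⟩ := hcon
  have h1 : ε ^ 2 ≤ T * p₀ := by nlinarith [mul_le_mul hTe h0e hε.le hT]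
  have h2 : C * (p₁ + p₂) < C * (ε ^ 2 / (2 * C) + ε ^ 2 / (2 * C)) := by
    exact mul_lt_mul_of_pos_left (add_lt_add hp1 hp2) hC
  have h3 : C * (ε ^ 2 / (2 * C) + ε ^ 2 / (2 * C)) = ε ^ 2 := by field_simp; ring
  linarith

end TransplantDictionary

end Summit.CriticalPhenomena.PercolationContinuityZ3.Theorems

end
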